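import Mathlib.Topology.Algebra.OpenSubgroup
import Mathlib.Topology.Homeomorph.Lemmas
import Literature.AnabelianGeometry.SemiGraphs.TemperedReconstructionReductions
import Literature.AnabelianGeometry.SemiGraphs.TreeFixedPairProofs
import HarnessLib

/-!
# Semi-graphs of anabelioids, §3: Corollary 3.9, step (a) — an induced morphism is quasi-geometric
# (residual R0 of the reduction, from Theorem 3.7 (i), (iv))

Mochizuki, *Semi-graphs of anabelioids*, Publ. RIMS **42** (2006), §3, Corollary 3.9, proof, manuscript
p. 42 [cite: MochizukiSemiAnbd2006, Cor 3.9 p.42]: "any locally open morphism of semi-graphs of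
anabelioids `G → H` determines a morphism of temperoids `B^temp(G) → B^temp(H)` [cf. Proposition 3.6,
(iv)] whose quasi-geometricity follows by 'substituting' the equivalences of Theorem 3.7, (iv), into
Definition 3.8."  Proof-only companion of `TemperedReconstructionReductions.lean`: the residual named
fact `InducedIsQuasiGeometric` (R0) is REDUCED to the typed named facts `MaximalCompactIffVerticial`
(Thm. 3.7 (iv)) and `VerticialInjective` (Thm. 3.7 (i)):

* a maximal compact subgroup of `π₁^temp(G)` is verticial, `K₁ = ψ_v(Π_v)`; compatibility gives
  `φ ∘ ψ_v = γ_g ∘ ψ_{F v} ∘ F_v`, so `φ(K₁) = j(F_v(Π_v))` for the injective continuous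
  `j = γ_g ∘ ψ_{F v} : Π_{F v} → π₁^temp(H)`, whose image `j(Π_{F v})` is verticial, hence maximal
  compact; `j` is a homeomorphism onto its (compact, Hausdorff) image, so the open subgroup
  `F_v(Π_v) ⊆ Π_{F v}` goes to an open subgroup of `j(Π_{F v})`;
* a nontrivial intersection of two distinct maximal compact subgroups is an edge-like subgroup of a
  CLOSED edge `e`; `F e` is closed, an edge homomorphism at `F e` is `ψ_w ∘ b_*` for a branch `b` of
  `F e` abutting to `w` (injective: Thm. 3.7 (i) and injective type), the same transport applies, and
  the target edge-like subgroup is nontrivial (the edge groups of `H` are nontrivial: `H` is totally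
  aloof and totally elevated) hence is such an intersection by Thm. 3.7 (iv) for `H`.

Nothing here takes a side on [IUTchIII] Cor. 3.12; typed ≠ discharged (R0 becomes a consequence of
Thm. 3.7 (i)(iv), themselves open named facts under discharge by the G10 ladder).
-/

open CategoryTheory Topology

namespace Literature.AnabelianGeometry.SemiGraphs

namespace ProfiniteSemiGraph

universe u

/-! ### Transport of an open subgroup through an injective continuous homomorphism of a compact group -/

/-- For `j : A → Γ` an injective continuous homomorphism from a compact group into a Hausdorff
topological group, `φ(K) = j(U)` with `U ⊆ A` open implies that `φ` "maps `K` surjectively onto an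
open subgroup of" `j(A)` (`MapsOntoOpenSubgroupOf`): `j` is a homeomorphism onto `j(A)`.
[cite: MochizukiSemiAnbd2006, Def 3.8 p.42] -/
theorem mapsOntoOpenSubgroupOf_of_eq_map {P : Type u} [Group P] {Γ : Type u} [Group Γ]
    [TopologicalSpace Γ] [T2Space Γ] {A : Type u} [Group A] [TopologicalSpace A] [CompactSpace A]
    (j : A →* Γ) (hjc : Continuous j) (hj : Function.Injective j) (φ : P →* Γ) (K : Subgroup P)
    (U : Subgroup A) (hU : IsOpen (U : Set A)) (hK : K.map φ = U.map j) :
    MapsOntoOpenSubgroupOf φ K ((⊤ : Subgroup A).map j) := by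
  refine ⟨hK ▸ Subgroup.map_mono le_top, ?_⟩
  let jK : A → ((⊤ : Subgroup A).map j) := fun a => ⟨j a, ⟨a, Subgroup.mem_top a, rfl⟩⟩
  have hcont : Continuous jK := hjc.subtype_mk _
  have hbij : Function.Bijective jK := by
    refine ⟨fun a b h => hj (congrArg Subtype.val h), fun y => ?_⟩
    obtain ⟨x, -, hx⟩ := y.2
    exact ⟨x, Subtype.ext hx⟩
  let e : A ≃ₜ ((⊤ : Subgroup A).map j) :=
    hcont.homeoOfEquivCompactToT2 (f := Equiv.ofBijective jK hbij)
  have himage : ((Subtype.val : ((⊤ : Subgroup A).map j) → Γ) ⁻¹' (K.map φ : Set Γ)) =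
      e '' (U : Set A) := by
    ext y
    rw [hK]
    constructor
    · rintro ⟨a, ha, hay⟩
      exact ⟨a, ha, Subtype.ext hay⟩
    · rintro ⟨a, ha, hae⟩
      exact ⟨a, ha, congrArg Subtype.val hae⟩
  rw [himage]
  exact e.isOpenMap _ hU

/-! ### Vertex groups of an elevated graph are infinite; edge groups of an aloof graph are nontrivial -/

variable {𝒢 ℋ : ProfiniteSemiGraph.{u}}

/-- An elevated vertex has an infinite group (its finite quotients `F_v` carry subgroups of every
order). [cite: MochizukiSemiAnbd2006, Def 2.4(i) p.25] -/
theorem infinite_gv_of_isElevatedVertex {v : 𝒢.graph.Vertex} (h : 𝒢.IsElevatedVertex v) :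
    Infinite (𝒢.Gv v) := by
  by_contra hinf
  haveI : Finite (𝒢.Gv v) := not_infinite_iff_finite.mp hinf
  obtain ⟨A, hA, N, hN, -⟩ := h (Nat.card (𝒢.Gv v) + 1)
  have h1 : Nat.card N ≤ Nat.card (A.FV v) :=
    Nat.card_le_card_of_injective (fun x : N => (x : A.FV v)) Subtype.val_injective
  have h2 : Nat.card (A.FV v) ≤ Nat.card (𝒢.Gv v) := Nat.card_le_card_of_surjective _ (hA.1 v)
  omega

/-- In a totally aloof semi-graph of anabelioids with infinite vertex groups, the group of an edge
that abuts to a vertex is nontrivial (an aloof edge has `Π_b` of infinite index in conjugates; with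
`Π_b` trivial and `g ≠ 1` the index would be `1`). [cite: MochizukiSemiAnbd2006, Def 2.4(iv) p.26] -/
theorem nontrivial_ge_of_isAloofEdge {b : ℋ.graph.Branch} {w : ℋ.graph.Vertex}
    (hb : ℋ.graph.abuts b = some w) (ha : ℋ.IsAloofEdge (ℋ.graph.edgeOf b))
    [Infinite (ℋ.Gv w)] : Nontrivial (ℋ.Ge (ℋ.graph.edgeOf b)) := by
  by_contra htriv
  rw [not_nontrivial_iff_subsingleton] at htriv
  -- the branch subgroup is trivial
  have hbot : ℋ.branchSubgroup b w hb = ⊥ := by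
    rw [eq_bot_iff]
    rintro _ ⟨x, rfl⟩
    rw [Subsingleton.elim x 1, map_one]
    exact (Subgroup.mem_bot).mpr rfl
  -- a nontrivial element of `Π_w`
  obtain ⟨g, hg⟩ := exists_ne (1 : ℋ.Gv w)
  have hg' : g ∉ ℋ.branchSubgroup b w hb := by
    rw [hbot, Subgroup.mem_bot]; exact hg
  have h0 := ha b rfl w hb b hb g (Or.inr hg')
  rw [hbot, Subgroup.map_bot, Subgroup.relIndex_bot_right] at h0
  exact one_ne_zero h0

/-! ### Edge homomorphisms from verticial homomorphisms -/

/-- `B^temp(φ ∘ β) ≅ B^temp(φ) ⋙ B^temp(β)` (local copy of t11's lemma in the unbuilt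
`TemperedEdgeInVerticialProofs`). [cite: MochizukiSemiAnbd2006, Rmk 3.1.2 pp.33-34] -/
private theorem nonempty_res_comp_iso' {G₁ G₂ G₃ : Type u} [Group G₁] [TopologicalSpace G₁]
    [Group G₂] [TopologicalSpace G₂] [Group G₃] [TopologicalSpace G₃]
    (β : G₁ →ₜ* G₂) (φ : G₂ →ₜ* G₃) :
    Nonempty (BTemp.res (φ.comp β) ≅ BTemp.res φ ⋙ BTemp.res β) := by
  refine ⟨NatIso.ofComponents (fun X =>
    { hom := BTemp.homOfEquivariant ((BTemp.res (φ.comp β)).obj X) ((BTemp.res φ ⋙ BTemp.res β).obj X)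
        id (fun _ _ => rfl)
      inv := BTemp.homOfEquivariant ((BTemp.res φ ⋙ BTemp.res β).obj X) ((BTemp.res (φ.comp β)).obj X)
        id (fun _ _ => rfl)
      hom_inv_id := by
        apply ObjectProperty.hom_ext
        apply Action.Hom.ext
        exact ConcreteCategory.hom_ext _ _ fun x => rfl
      inv_hom_id := by
        apply ObjectProperty.hom_ext
        apply Action.Hom.ext
        exact ConcreteCategory.hom_ext _ _ fun x => rfl }) (fun {X Y} f => ?_)⟩
  apply ObjectProperty.hom_ext
  apply Action.Hom.ext
  exact ConcreteCategory.hom_ext _ _ fun x => rfl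

/-- The gluings `S_e ≅ b^* S_v` are natural in `S` (local copy of t11's lemma).
[cite: MochizukiSemiAnbd2006, §3 p.36] -/
private theorem nonempty_restrictE_iso_restrictV_res' (b : ℋ.graph.Branch) (v : ℋ.graph.Vertex)
    (h : ℋ.graph.abuts b = some v) :
    Nonempty (restrictE ℋ (ℋ.graph.edgeOf b) ≅ restrictV ℋ v ⋙ BTemp.res (ℋ.brHom b v h)) :=
  ⟨NatIso.ofComponents (fun S => S.glue b v h) (fun f => f.comm b v h)⟩


/-- `ψ_w ∘ b_*` is an edge homomorphism at `e = edgeOf b` for a verticial homomorphism `ψ_w` at the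
vertex `w` to which `b` abuts (the gluing `S_e ≅ b^* S_v` is natural in `S`).
[cite: MochizukiSemiAnbd2006, Thm 3.7(iii) p.41] -/
theorem isEdgeHom_comp_brHom (c : TemperedPiChart ℋ) {b : ℋ.graph.Branch} {w : ℋ.graph.Vertex}
    (hb : ℋ.graph.abuts b = some w) {ψw : ℋ.Gv w →ₜ* c.G} (hψ : IsVerticialHom c w ψw) :
    IsEdgeHom c (ℋ.graph.edgeOf b) (ψw.comp (ℋ.brHom b w hb)) := by
  obtain ⟨iV⟩ := hψ
  obtain ⟨glue⟩ := nonempty_restrictE_iso_restrictV_res' b w hb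
  obtain ⟨comp⟩ := nonempty_res_comp_iso' (ℋ.brHom b w hb) ψw
  exact ⟨Functor.isoWhiskerLeft c.equiv.inverse (Functor.isoWhiskerLeft (ObjectProperty.ι _) glue) ≪≫
    Functor.isoWhiskerLeft c.equiv.inverse (Functor.associator _ _ _).symm ≪≫
    (Functor.associator _ _ _).symm ≪≫ Functor.isoWhiskerRight iV (BTemp.res (ℋ.brHom b w hb)) ≪≫
    comp.symm⟩

/-- Conjugates of edge-like subgroups are edge-like (as for verticial subgroups,
`conj_mem_verticialSubgroups`). [cite: MochizukiSemiAnbd2006, Thm 3.7(iii) p.41] -/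
theorem conj_mem_edgeLikeSubgroups' (c : TemperedPiChart ℋ) {e : ℋ.graph.Edge} {H : Subgroup c.G}
    (hH : H ∈ edgeLikeSubgroups c e) (g : c.G) :
    H.map (MulAut.conj g).toMonoidHom ∈ edgeLikeSubgroups c e := by
  obtain ⟨φ, ⟨i⟩, rfl⟩ := hH
  let ψ : ℋ.Ge e →ₜ* c.G :=
    { toMonoidHom := (MulAut.conj g).toMonoidHom.comp φ.toMonoidHom
      continuous_toFun := by
        exact ((continuous_const.mul continuous_id).mul continuous_const).comp φ.continuous }
  have hg : ∀ a, g * φ a * g⁻¹ = ψ a := fun a => rfl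
  exact ⟨ψ, ⟨i ≪≫ BTemp.resIsoOfConj φ ψ g hg⟩, (range_eq_map_conj_of_conj_eq c φ ψ g hg).symm⟩

/-! ### Closed edges (local copies of two small lemmas of `TreeSystemFixedClosedEdges`, adapted) -/

/-- A closed edge has a branch abutting to a vertex. [cite: MochizukiSemiAnbd2006, §1 p.12] -/
private theorem exists_branch_of_isClosedEdge {G : SemiGraph.{u}} {e : G.Edge}
    (he : G.IsClosedEdge e) : ∃ (c : G.Branch) (w : G.Vertex), G.edgeOf c = e ∧ G.abuts c = some w := by
  unfold SemiGraph.IsClosedEdge SemiGraph.vertCard at he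
  obtain ⟨x, -, -, -⟩ := Nat.card_eq_two_iff.mp he
  obtain ⟨w, hw⟩ := Option.isSome_iff_exists.mp x.2.2
  exact ⟨x.1, w, x.2.1, hw⟩

/-- A morphism of semi-graphs maps closed edges to closed edges. [cite: MochizukiSemiAnbd2006, §1 p.12] -/
private theorem isClosedEdge_edgeMap' {G H : SemiGraph.{u}} (φ : G ⟶ H) {e : G.Edge}
    (he : G.IsClosedEdge e) : H.IsClosedEdge (φ.edgeMap e) := by
  unfold SemiGraph.IsClosedEdge SemiGraph.vertCard at he
  obtain ⟨x, y, hxy, -⟩ := Nat.card_eq_two_iff.mp he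
  obtain ⟨w, hw⟩ := Option.isSome_iff_exists.mp x.2.2
  obtain ⟨w', hw'⟩ := Option.isSome_iff_exists.mp y.2.2
  refine SemiGraph.isClosedEdge_of_abuts (c := φ.branchMap x.1) (c' := φ.branchMap y.1)
    (fun h => hxy (Subtype.ext (φ.branchMap_injOn x.1 y.1 (x.2.1.trans y.2.1.symm) h))) ?_ ?_
    (φ.abuts_branchMap x.1 w hw) (φ.abuts_branchMap y.1 w' hw')
  · rw [φ.edgeOf_branchMap, x.2.1]
  · rw [φ.edgeOf_branchMap, y.2.1]

/-! ### R0 from Theorem 3.7 (i), (iv) -/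

/-- The image description common to both clauses: from `φ (ψ x) = g * ψ' (η x) * g⁻¹` for all `x`,
`φ(ψ(Π)) = j(η(Π))` with `j = γ_g ∘ ψ'`, and `j(⊤) = γ_g(ψ'(⊤))`. [folklore] -/
private theorem map_range_eq {P : Type u} [Group P] {Γ : Type u} [Group Γ] {A B : Type u} [Group A]
    [Group B] (φ : P →* Γ) (ψ : A →* P) (ψ' : B →* Γ) (η : A →* B) (g : Γ)
    (hg : ∀ x, φ (ψ x) = g * ψ' (η x) * g⁻¹) :
    ψ.range.map φ = η.range.map ((MulAut.conj g).toMonoidHom.comp ψ') ∧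
      (⊤ : Subgroup B).map ((MulAut.conj g).toMonoidHom.comp ψ') =
        ψ'.range.map (MulAut.conj g).toMonoidHom := by
  constructor
  · ext y
    constructor
    · rintro ⟨_, ⟨x, rfl⟩, rfl⟩
      exact ⟨η x, ⟨x, rfl⟩, (hg x).symm⟩
    · rintro ⟨_, ⟨x, rfl⟩, rfl⟩
      exact ⟨ψ x, ⟨x, rfl⟩, hg x⟩
  · rw [MonoidHom.range_eq_map, Subgroup.map_map]

/-- **R0 from Thm. 3.7 (i), (iv)** ([SemiAnbd] Cor. 3.9, proof, p. 42: "whose quasi-geometricity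
follows by 'substituting' the equivalences of Theorem 3.7, (iv), into Definition 3.8"): a
homomorphism compatible with a locally open morphism on verticial and edge homomorphisms is
quasi-geometric. [cite: MochizukiSemiAnbd2006, Cor 3.9 p.42] -/
theorem InducedIsQuasiGeometric_of (h37i : VerticialInjective.{u})
    (h37iv : MaximalCompactIffVerticial.{u}) : InducedIsQuasiGeometric.{u} := by
  intro 𝒢 ℋ h𝒢 hℋ c𝒢 cℋ F φ hF hV hE
  haveI := cℋ.t2Space
  have h37𝒢 := h𝒢.thm37Hypotheses
  have h37ℋ := hℋ.thm37Hypotheses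
  obtain ⟨hmax𝒢, hint𝒢⟩ := h37iv 𝒢 h37𝒢 c𝒢
  obtain ⟨hmaxℋ, hintℋ⟩ := h37iv ℋ h37ℋ cℋ
  refine ⟨fun K₁ hK₁ => ?_, fun K₁ H₁ hK₁ hH₁ hne hnt => ?_⟩
  · -- maximal compact subgroups
    obtain ⟨v, ψ, ⟨eψ⟩, rfl⟩ := (hmax𝒢 K₁).mp hK₁
    obtain ⟨⟨_, ψ₁, ⟨e₁⟩, rfl⟩, hinj₁⟩ := h37i ℋ h37ℋ cℋ (F.base.vertexMap v)
    obtain ⟨g, hg⟩ := hV v ψ ψ₁ ⟨eψ⟩ ⟨e₁⟩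
    let j : ℋ.Gv (F.base.vertexMap v) →* cℋ.G := (MulAut.conj g).toMonoidHom.comp ψ₁.toMonoidHom
    have hjc : Continuous j :=
      ((continuous_const.mul ψ₁.continuous).mul continuous_const :)
    have hj : Function.Injective j := fun a b h => hinj₁ ψ₁ ⟨e₁⟩ ((MulAut.conj g).injective h)
    obtain ⟨hK, htop⟩ := map_range_eq φ.toMonoidHom ψ.toMonoidHom ψ₁.toMonoidHom
      (F.hV v).toMonoidHom g hg
    refine ⟨(⊤ : Subgroup _).map j, (hmaxℋ _).mpr ⟨F.base.vertexMap v, ?_⟩,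
      mapsOntoOpenSubgroupOf_of_eq_map j hjc hj φ.toMonoidHom _ _ (hF.1 v) hK⟩
    rw [htop]
    exact conj_mem_verticialSubgroups cℋ ⟨ψ₁, ⟨e₁⟩, rfl⟩ g
  · -- nontrivial intersections of two distinct maximal compact subgroups
    obtain ⟨e, he, ψ, ⟨eψ⟩, hL⟩ := (hint𝒢 (K₁ ⊓ H₁) hnt).mp ⟨K₁, H₁, hK₁, hH₁, hne, rfl⟩
    rw [hL]
    -- a branch `b` of the closed edge `F e`, abutting to `w`
    have he' : ℋ.graph.IsClosedEdge (F.base.edgeMap e) := isClosedEdge_edgeMap' F.base he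
    obtain ⟨b, w, hbe, hbw⟩ := exists_branch_of_isClosedEdge he'
    -- an edge homomorphism at `F e`: `ψ_w ∘ b_*`, injective
    obtain ⟨⟨_, ψw, ⟨ew⟩, rfl⟩, hinjw⟩ := h37i ℋ h37ℋ cℋ w
    have key : ∀ (f : ℋ.graph.Edge) (hf : ℋ.graph.edgeOf b = f), ℋ.graph.IsClosedEdge f →
        ∀ (η : 𝒢.Ge e →ₜ* ℋ.Ge f), IsOpen (η.toMonoidHom.range : Set (ℋ.Ge f)) →
        (∀ ψ' : ℋ.Ge f →ₜ* cℋ.G, IsEdgeHom cℋ f ψ' → ∃ g : cℋ.G, ∀ x, φ (ψ x) = g * ψ' (η x) * g⁻¹) →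
        ∃ K₂ H₂ : Subgroup cℋ.G, IsMaximalCompactSubgroup K₂ ∧ IsMaximalCompactSubgroup H₂ ∧
          K₂ ≠ H₂ ∧ K₂ ⊓ H₂ ≠ ⊥ ∧
          MapsOntoOpenSubgroupOf φ.toMonoidHom ψ.toMonoidHom.range (K₂ ⊓ H₂) := by
      intro f hf hfc η hη hcomp
      subst hf
      let ψ' : ℋ.Ge (ℋ.graph.edgeOf b) →ₜ* cℋ.G := ψw.comp (ℋ.brHom b w hbw)
      have hψ' : IsEdgeHom cℋ (ℋ.graph.edgeOf b) ψ' := isEdgeHom_comp_brHom cℋ hbw ⟨ew⟩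
      have hinj' : Function.Injective ψ' :=
        (hinjw ψw ⟨ew⟩).comp (hℋ.isOfInjectiveType b w hbw)
      obtain ⟨g, hg⟩ := hcomp ψ' hψ'
      let j : ℋ.Ge (ℋ.graph.edgeOf b) →* cℋ.G := (MulAut.conj g).toMonoidHom.comp ψ'.toMonoidHom
      have hjc : Continuous j := ((continuous_const.mul ψ'.continuous).mul continuous_const :)
      have hj : Function.Injective j := fun a a' h => hinj' ((MulAut.conj g).injective h)
      obtain ⟨hK, htop⟩ := map_range_eq φ.toMonoidHom ψ.toMonoidHom ψ'.toMonoidHom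
        η.toMonoidHom g hg
      -- the target edge-like subgroup `j(Π_{F e})`, nontrivial
      have hL₂ : (⊤ : Subgroup _).map j ∈ edgeLikeSubgroups cℋ (ℋ.graph.edgeOf b) := by
        rw [htop]
        exact conj_mem_edgeLikeSubgroups' cℋ ⟨ψ', hψ', rfl⟩ g
      haveI : Infinite (ℋ.Gv w) := infinite_gv_of_isElevatedVertex (hℋ.isTotallyElevated w)
      haveI : Nontrivial (ℋ.Ge (ℋ.graph.edgeOf b)) :=
        nontrivial_ge_of_isAloofEdge hbw (hℋ.isTotallyAloof _)
      have hL₂ne : (⊤ : Subgroup _).map j ≠ ⊥ := by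
        intro h0
        obtain ⟨x, hx⟩ := exists_ne (1 : ℋ.Ge (ℋ.graph.edgeOf b))
        have : j x ∈ ((⊤ : Subgroup _).map j) := ⟨x, Subgroup.mem_top x, rfl⟩
        rw [h0, Subgroup.mem_bot, ← map_one j] at this
        exact hx (hj this)
      obtain ⟨K₂, H₂, hK₂, hH₂, hne₂, hKH⟩ := (hintℋ _ hL₂ne).mpr ⟨_, hfc, hL₂⟩
      refine ⟨K₂, H₂, hK₂, hH₂, hne₂, hKH ▸ hL₂ne, ?_⟩
      rw [← hKH]
      exact mapsOntoOpenSubgroupOf_of_eq_map j hjc hj φ.toMonoidHom _ _ hη hK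
    exact key (F.base.edgeMap e) hbe he' (F.hE e) (hF.2 e) fun ψ' hψ' => hE e ψ ψ' ⟨eψ⟩ hψ'

/-- **Cor. 3.9 from Thm. 3.7 (i), (ii), (iv) and the residuals R1–R4** (R0 eliminated by
`InducedIsQuasiGeometric_of`). [cite: MochizukiSemiAnbd2006, Cor 3.9 pp.42-43] -/
theorem corollary_3_9_of_thm37 (h37i : VerticialInjective.{u}) (h37ii : VerticialDistinct.{u})
    (h37iv : MaximalCompactIffVerticial.{u}) (hR1 : InducesCompatible.{u})
    (hR2 : QuasiGeometricGraphData.{u}) (hR3 : InducesOfCompatible.{u})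
    (hR4 : CompatibleEdgeMapUnique.{u}) : Cor39.{u} :=
  corollary_3_9_of_steps h37i h37ii hR1 (InducedIsQuasiGeometric_of h37i h37iv) hR2 hR3 hR4

end ProfiniteSemiGraph

end Literature.AnabelianGeometry.SemiGraphs
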